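import Summits.MatrixMultiplication.MatrixMultiplication.Theorems.ObstructionDescentPolarForm

/- `set_option linter.dupNamespace false` as in the sibling kernel files (namespace `…Theorems.<FileStem>`). -/
set_option linter.dupNamespace false

/-!
# Multilinearity of the polar form and the diagonal identity (decomp-mm · lens 3 · gen 23, K2b)

Context: route `route-MatrixMultiplication-ObstructionDescent`, aside `GapOneEquationsVanish` (item 27778); continues
`ObstructionDescentPolarForm` (K2a).  For `f : MvPolynomial (Fin N × Fin N × Fin N) ℂ` the polar form
`polarForm f y = [μ_1 ⋯ μ_d] f(Σ_k μ_k y_k)` is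

* MULTILINEAR in the slots (`polarForm_update_add_smul`, packaged as `polarMultilinear`).  Proof by one substitution:
  with an extra variable `ν` carrying a tensor `u'`, the substitution `ν ↦ b μ_i, μ_i ↦ a μ_i` maps
  `f(Σ_k μ_k y_k + ν u')` to `f(Σ_k μ_k y'_k)` with `y'_i = a y_i + b u'`, and on the coefficient of `μ_1 ⋯ μ_d` it acts
  as `a·[μ_1⋯μ_d] + b·[ν · Π_{k≠i} μ_k]` (`coeff_ones_subst`);
* DIAGONAL: for `f` homogeneous of degree `e`, `f(Σ_k μ_k x) = f(x) · (Σ_k μ_k)^e` (`Dpoly_diag`), and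
  `[μ_1 ⋯ μ_d] (Σ_k μ_k)^d = d! ≠ 0` (`coeff_ones_sum_X_pow`, via the multinomial theorem);
* hence the RECONSTRUCTION `eq_zero_of_G3_eq_zero`: a homogeneous `f` of degree `d` whose coefficient tensor
  `G3 f` (K2a) vanishes is zero — expand the diagonal by multilinearity over the basis triads.
Part K2c (the eight-term relation and the assembly with the Casimir kernels) completes the bridge.
-/

namespace Summit.MatrixMultiplication.MatrixMultiplication.Theorems.ObstructionDescentPolarLinear

open MvPolynomial Finset
open ObstructionDescentPolarForm

variable {N d : ℕ}

/-! ## The substitution -/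

/-- Extended slot tensor: slot `k` on the variable `some k`, the extra tensor `u'` on the variable `none`. [this cell] -/
noncomputable def extTensor (y : Fin d → Pt N → ℂ) (u' : Pt N → ℂ) :
    Pt N → MvPolynomial (Option (Fin d)) ℂ :=
  fun p => (∑ k, C (y k p) * X (some k)) + C (u' p) * X none

/-- The substitution `θ_{a,b}`: `ν ↦ b μ_i`, `μ_i ↦ a μ_i`, `μ_k ↦ μ_k` (`k ≠ i`). [this cell] -/
noncomputable def subst (i : Fin d) (a b : ℂ) :
    MvPolynomial (Option (Fin d)) ℂ →ₐ[ℂ] MvPolynomial (Fin d) ℂ :=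
  aeval fun o => Option.elim o (C b * X i) (fun k => C (if k = i then a else 1) * X k)

/-- `θ_{a,b}` on the variables. [this cell] -/
theorem subst_X_none (i : Fin d) (a b : ℂ) : subst i a b (X none) = C b * X i := by
  simp [subst]

/-- `θ_{a,b}` on the variables. [this cell] -/
theorem subst_X_some (i : Fin d) (a b : ℂ) (k : Fin d) :
    subst i a b (X (some k)) = C (if k = i then a else 1) * X k := by
  simp only [subst, aeval_X, Option.elim_some]

/-- The substitution maps the extended slot tensor to the slot tensor with slot `i` replaced by `a y_i + b u'`.
[this cell] -/
theorem subst_extTensor [DecidableEq (Fin d)] (y : Fin d → Pt N → ℂ) (u' : Pt N → ℂ) (i : Fin d)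
    (a b : ℂ) (p : Pt N) :
    subst i a b (extTensor y u' p) = slotTensor (Function.update y i (a • y i + b • u')) p := by
  have hR : ∀ k, C ((Function.update y i (a • y i + b • u')) k p) * (X k : MvPolynomial (Fin d) ℂ)
      = C (y k p) * (C (if k = i then a else 1) * X k) + (if k = i then C (b * u' p) * X i else 0) := by
    intro k
    by_cases hk : k = i
    · subst hk
      simp only [Function.update_self, Pi.add_apply, Pi.smul_apply, smul_eq_mul, if_true, map_add, map_mul]
      ring
    · simp only [Function.update_of_ne hk, if_neg hk, map_one, one_mul, add_zero]
  simp only [slotTensor]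
  rw [Finset.sum_congr rfl (fun k _ => hR k), Finset.sum_add_distrib, Finset.sum_ite_eq' univ i,
    if_pos (mem_univ _)]
  simp only [extTensor, map_add, map_sum, map_mul, subst_X_some, subst_X_none]
  simp only [subst, aeval_C, algebraMap_eq]
  ring

/-! ## The coefficient of `μ_1 ⋯ μ_d` after the substitution -/

/-- The exponent `(ν ↦ 0, μ_k ↦ 1)`. [this cell] -/
noncomputable def E1 (d : ℕ) : Option (Fin d) →₀ ℕ :=
  Finsupp.equivFunOnFinite.symm fun o => Option.elim o 0 (fun _ => 1)

/-- The exponent `(ν ↦ 1, μ_i ↦ 0, μ_k ↦ 1 for k ≠ i)`. [this cell] -/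
noncomputable def E2 (i : Fin d) : Option (Fin d) →₀ ℕ :=
  Finsupp.equivFunOnFinite.symm fun o => Option.elim o 1 (fun k => if k = i then 0 else 1)

/-- Values of `ones`. [this cell] -/
theorem ones_apply (k : Fin d) : ones d k = 1 := by
  simp [ones, Finsupp.finsetSum_apply, Finsupp.single_apply]

/-- The coefficient of `μ_1 ⋯ μ_d` in a product of powers of the variables. [this cell] -/
theorem coeff_ones_prod_X_pow (t : Fin d → ℕ) :
    coeff (ones d) (∏ k, (X k : MvPolynomial (Fin d) ℂ) ^ t k) = if (∀ k, t k = 1) then 1 else 0 := by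
  classical
  rw [coeff_prod_X_pow]
  congr 1
  apply propext
  constructor
  · intro h k
    have := congrArg (fun m => m k) h
    simp only [ones_apply, Finsupp.indicator_apply, mem_univ, dite_true] at this
    exact this.symm
  · intro h
    ext k
    simp [ones_apply, Finsupp.indicator_apply, h k]

/-- The substitution on a monomial. [this cell] -/
theorem subst_monomial (i : Fin d) (a b : ℂ) (s : Option (Fin d) →₀ ℕ) (r : ℂ) :
    subst i a b (monomial s r)
      = C (r * b ^ (s none) * ∏ k, (if k = i then a else 1) ^ (s (some k)))
        * ∏ k, (X k : MvPolynomial (Fin d) ℂ) ^ (s (some k) + if k = i then s none else 0) := by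
  rw [subst, aeval_monomial, algebraMap_eq, Finsupp.prod_fintype _ _ (fun o => by simp),
    Fintype.prod_option]
  simp only [Option.elim_none, Option.elim_some]
  have hX : ∏ k, (X k : MvPolynomial (Fin d) ℂ) ^ (if k = i then s none else 0) = X i ^ (s none) := by
    rw [Finset.prod_eq_single i (fun k _ hk => by simp [hk]) (fun h => absurd (mem_univ i) h), if_pos rfl]
  rw [show (∏ k, (X k : MvPolynomial (Fin d) ℂ) ^ (s (some k) + if k = i then s none else 0))
      = (∏ k, (X k : MvPolynomial (Fin d) ℂ) ^ (s (some k))) * X i ^ (s none) by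
    rw [← hX, ← Finset.prod_mul_distrib]
    exact Finset.prod_congr rfl fun k _ => pow_add _ _ _]
  simp only [mul_pow, ← map_pow, Finset.prod_mul_distrib, ← map_prod, map_mul]
  ring

/-- `E1 ≠ E2 i`. [this cell] -/
theorem E1_ne_E2 (i : Fin d) : E1 d ≠ E2 i := by
  intro h
  have := congrArg (fun m => m none) h
  simp [E1, E2] at this

/-- Which monomials hit `μ_1 ⋯ μ_d` under the substitution. [this cell] -/
theorem cond_iff (i : Fin d) (s : Option (Fin d) →₀ ℕ) :
    (∀ k : Fin d, s (some k) + (if k = i then s none else 0) = 1) ↔ (s = E1 d ∨ s = E2 i) := by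
  constructor
  · intro h
    have hi := h i
    rw [if_pos rfl] at hi
    have hk : ∀ k, k ≠ i → s (some k) = 1 := fun k hk => by simpa [if_neg hk] using h k
    rcases Nat.eq_zero_or_pos (s none) with h0 | hpos
    · left
      ext o
      cases o with
      | none => simpa [E1] using h0
      | some k =>
        by_cases hki : k = i
        · subst hki; simp [E1]; omega
        · simp [E1, hk k hki]
    · right
      ext o
      cases o with
      | none => simp [E2]; omega
      | some k =>
        by_cases hki : k = i
        · subst hki; simp [E2]; omega
        · simp [E2, hk k hki, hki]
  · rintro (rfl | rfl) k
    · simp [E1]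
    · by_cases hki : k = i
      · subst hki; simp [E2]
      · simp [E2, hki]

/-- MASTER COEFFICIENT FORMULA: on the coefficient of `μ_1 ⋯ μ_d` the substitution `θ_{a,b}` acts as
`a · [Π_k μ_k] + b · [ν · Π_{k ≠ i} μ_k]`. [this cell] -/
theorem coeff_ones_subst (i : Fin d) (a b : ℂ) (g : MvPolynomial (Option (Fin d)) ℂ) :
    coeff (ones d) (subst i a b g) = a * coeff (E1 d) g + b * coeff (E2 i) g := by
  classical
  induction g using MvPolynomial.induction_on' with
  | monomial s r =>
    rw [subst_monomial, coeff_C_mul, coeff_ones_prod_X_pow, coeff_monomial, coeff_monomial]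
    by_cases h1 : s = E1 d
    · subst h1
      have hc : ∀ k : Fin d, (E1 d) (some k) + (if k = i then (E1 d) none else 0) = 1 :=
        (cond_iff i _).2 (Or.inl rfl)
      rw [if_pos hc, if_pos rfl, if_neg (E1_ne_E2 i)]
      simp only [show (E1 d) none = 0 from rfl, show ∀ k, (E1 d) (some k) = 1 from fun k => rfl, pow_zero,
        pow_one, Finset.prod_ite_eq', mem_univ, if_true]
      ring
    by_cases h2 : s = E2 i
    · subst h2
      have hc : ∀ k : Fin d, (E2 i) (some k) + (if k = i then (E2 i) none else 0) = 1 :=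
        (cond_iff i _).2 (Or.inr rfl)
      rw [if_pos hc, if_neg (fun h => h1 h), if_pos rfl]
      have hprod : ∏ k : Fin d, (if k = i then a else 1) ^ ((E2 i) (some k)) = 1 :=
        Finset.prod_eq_one fun k _ => by
          by_cases hk : k = i
          · subst hk; simp [E2]
          · simp [E2, hk]
      simp only [show (E2 i) none = 1 from rfl, pow_one, hprod]
      ring
    · have hc : ¬ ∀ k : Fin d, s (some k) + (if k = i then s none else 0) = 1 := fun h =>
        (((cond_iff i s).1 h).elim h1 h2)
      rw [if_neg hc, if_neg h1, if_neg h2]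
      ring
  | add p q hp hq =>
    rw [map_add, coeff_add, coeff_add, coeff_add, hp, hq]
    ring

/-! ## Multilinearity -/

/-- The slot polynomial with slot `i` replaced by `a y_i + b u'` is the substitution image of
`f(Σ_k μ_k y_k + ν u')`. [this cell] -/
theorem Dpoly_update_eq_subst [DecidableEq (Fin d)] (f : MvPolynomial (Pt N) ℂ) (y : Fin d → Pt N → ℂ)
    (u' : Pt N → ℂ) (i : Fin d) (a b : ℂ) :
    Dpoly f (Function.update y i (a • y i + b • u')) = subst i a b (aeval (extTensor y u') f) := by
  have hs : slotTensor (Function.update y i (a • y i + b • u')) = fun p => subst i a b (extTensor y u' p) :=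
    funext fun p => (subst_extTensor y u' i a b p).symm
  unfold Dpoly
  rw [hs, ← comp_aeval, AlgHom.comp_apply]

/-- The polar form with slot `i` replaced by `a y_i + b u'`, in terms of two coefficients of
`f(Σ_k μ_k y_k + ν u')`. [this cell] -/
theorem polarForm_update_master [DecidableEq (Fin d)] (f : MvPolynomial (Pt N) ℂ)
    (y : Fin d → Pt N → ℂ) (u' : Pt N → ℂ) (i : Fin d) (a b : ℂ) :
    polarForm f (Function.update y i (a • y i + b • u'))
      = a * coeff (E1 d) (aeval (extTensor y u') f) + b * coeff (E2 i) (aeval (extTensor y u') f) := by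
  unfold polarForm
  rw [Dpoly_update_eq_subst, coeff_ones_subst]

/-- MULTILINEARITY of the polar form in each slot. [this cell; classical polarisation] -/
theorem polarForm_update_add_smul [DecidableEq (Fin d)] (f : MvPolynomial (Pt N) ℂ)
    (y : Fin d → Pt N → ℂ) (i : Fin d) (u u' : Pt N → ℂ) (a b : ℂ) :
    polarForm f (Function.update y i (a • u + b • u'))
      = a * polarForm f (Function.update y i u) + b * polarForm f (Function.update y i u') := by
  have h1 : Function.update y i (a • u + b • u')
      = Function.update (Function.update y i u) i (a • (Function.update y i u) i + b • u') := by
    simp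
  have h2 : polarForm f (Function.update y i u) = polarForm f
      (Function.update (Function.update y i u) i ((1 : ℂ) • (Function.update y i u) i + (0 : ℂ) • u')) := by
    simp
  have h3 : Function.update y i u'
      = Function.update (Function.update y i u) i ((0 : ℂ) • (Function.update y i u) i + (1 : ℂ) • u') := by
    simp
  rw [h2, h3, h1, polarForm_update_master, polarForm_update_master, polarForm_update_master]
  ring

/-- The polar form as a multilinear map in the `d` slots. [this cell] -/
noncomputable def polarMultilinear (f : MvPolynomial (Pt N) ℂ) (d : ℕ) :
    MultilinearMap ℂ (fun _ : Fin d => Pt N → ℂ) ℂ where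
  toFun y := polarForm f y
  map_update_add' := by
    intro _ y i u u'
    simpa using polarForm_update_add_smul f y i u u' 1 1
  map_update_smul' := by
    intro _ y i c u
    simpa using polarForm_update_add_smul f y i u u c 0

/-- Unfolding lemma. [this cell] -/
@[simp] theorem polarMultilinear_apply (f : MvPolynomial (Pt N) ℂ) (y : Fin d → Pt N → ℂ) :
    polarMultilinear f d y = polarForm f y := rfl

/-! ## The diagonal -/

/-- On the diagonal the slot tensor is `x · (Σ_k μ_k)`. [this cell] -/
theorem slotTensor_diag (x : Pt N → ℂ) (p : Pt N) :
    slotTensor (fun _ : Fin d => x) p = C (x p) * ∑ k : Fin d, X k := by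
  simp [slotTensor, Finset.mul_sum]

/-- DIAGONAL IDENTITY: for `f` homogeneous of degree `e`, `f(Σ_k μ_k x) = f(x) · (Σ_k μ_k)^e`. [this cell] -/
theorem Dpoly_diag (f : MvPolynomial (Pt N) ℂ) {e : ℕ} (hf : f.IsHomogeneous e) (x : Pt N → ℂ) :
    Dpoly f (fun _ : Fin d => x) = C (eval x f) * (∑ k : Fin d, X k) ^ e := by
  have hslot : slotTensor (fun _ : Fin d => x) = fun p => C (x p) * ∑ k : Fin d, X k :=
    funext (slotTensor_diag x)
  unfold Dpoly
  rw [hslot]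
  set S : MvPolynomial (Fin d) ℂ := ∑ k : Fin d, X k
  have key : ∀ s ∈ f.support, aeval (fun p => C (x p) * S) (monomial s (coeff s f))
      = C (eval x (monomial s (coeff s f))) * S ^ e := by
    intro s hs
    have hdeg : s.degree = e := by
      by_contra hne
      exact (mem_support_iff.mp hs) (hf.coeff_eq_zero hne)
    rw [aeval_monomial, algebraMap_eq, eval_monomial, Finsupp.prod, Finsupp.prod]
    simp only [mul_pow, Finset.prod_mul_distrib, Finset.prod_pow_eq_pow_sum, map_mul, map_prod, map_pow]
    rw [← Finsupp.degree_apply, hdeg]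
    ring
  conv_lhs => rw [f.as_sum, map_sum]
  conv_rhs => rw [f.as_sum, map_sum, map_sum, Finset.sum_mul]
  exact Finset.sum_congr rfl key

/-- The polar form on the diagonal: `f(x)` times the universal constant `[μ_1 ⋯ μ_d] (Σ_k μ_k)^e`. [this cell] -/
theorem polarForm_diag (f : MvPolynomial (Pt N) ℂ) {e : ℕ} (hf : f.IsHomogeneous e) (x : Pt N → ℂ) :
    polarForm f (fun _ : Fin d => x) = eval x f * coeff (ones d) ((∑ k : Fin d, X k) ^ e) := by
  rw [polarForm, Dpoly_diag f hf x, coeff_C_mul]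

/-- The universal constant: `[μ_1 ⋯ μ_d] (Σ_k μ_k)^d` is the multinomial coefficient `d!/(1!⋯1!) = d!`.
[this cell; multinomial theorem] -/
theorem coeff_ones_sum_X_pow (d : ℕ) :
    coeff (ones d) ((∑ k : Fin d, (X k : MvPolynomial (Fin d) ℂ)) ^ d)
      = (Nat.multinomial univ (fun _ : Fin d => 1) : ℂ) := by
  classical
  rw [Finset.sum_pow_eq_sum_piAntidiag, coeff_sum]
  have hterm : ∀ k : Fin d → ℕ, coeff (ones d) ((Nat.multinomial univ k : MvPolynomial (Fin d) ℂ)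
      * ∏ i, (X i : MvPolynomial (Fin d) ℂ) ^ k i)
      = if (∀ i, k i = 1) then (Nat.multinomial univ k : ℂ) else 0 := by
    intro k
    rw [← map_natCast (C : ℂ →+* MvPolynomial (Fin d) ℂ), coeff_C_mul, coeff_ones_prod_X_pow]
    split_ifs <;> simp
  simp_rw [hterm]
  rw [Finset.sum_ite, Finset.sum_const_zero, add_zero]
  have hfilter : (piAntidiag (univ : Finset (Fin d)) d).filter (fun k => ∀ i, k i = 1)
      = {fun _ => 1} := by
    ext k
    simp only [mem_filter, mem_piAntidiag, mem_singleton]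
    constructor
    · rintro ⟨-, h⟩
      exact funext h
    · rintro rfl
      refine ⟨⟨by simp, fun _ _ => mem_univ _⟩, fun _ => rfl⟩
  rw [hfilter, Finset.sum_singleton]

/-- … and in particular it is nonzero. [this cell] -/
theorem coeff_ones_sum_X_pow_ne_zero (d : ℕ) :
    coeff (ones d) ((∑ k : Fin d, (X k : MvPolynomial (Fin d) ℂ)) ^ d) ≠ 0 := by
  rw [coeff_ones_sum_X_pow]
  exact_mod_cast (Nat.multinomial_pos _ _).ne'

/-! ## Reconstruction from the coefficient tensor -/

/-- Expansion of the diagonal polar form over basis triads. [this cell] -/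
theorem polarForm_diag_expand (f : MvPolynomial (Pt N) ℂ) (x : Pt N → ℂ) :
    polarForm f (fun _ : Fin d => x)
      = ∑ π : Fin d → Pt N, (∏ k, x (π k)) * polarForm f (fun k => basisTensor (π k)) := by
  classical
  have h0 : (fun _ : Fin d => x) = fun k : Fin d => ∑ q : Pt N, x q • (basisTensor q : Pt N → ℂ) := by
    funext k p
    simp only [Finset.sum_apply, Pi.smul_apply, smul_eq_mul, basisTensor, mul_ite, mul_one, mul_zero,
      Finset.sum_ite_eq, mem_univ, if_true]
  rw [← polarMultilinear_apply, h0, MultilinearMap.map_sum (polarMultilinear f d) (fun _ q => x q • basisTensor q)]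
  refine Finset.sum_congr rfl fun π _ => ?_
  rw [MultilinearMap.map_smul_univ, polarMultilinear_apply, smul_eq_mul]

/-- RECONSTRUCTION: a homogeneous polynomial of degree `d` whose coefficient tensor `G3` vanishes is zero.
[this cell; classical polarisation] -/
theorem eq_zero_of_G3_eq_zero (f : MvPolynomial (Pt N) ℂ) (hf : f.IsHomogeneous d)
    (hG : ∀ α β γ : Fin d → Fin N, G3 f α β γ = 0) : f = 0 := by
  apply MvPolynomial.funext
  intro x
  rw [map_zero]
  have h1 := polarForm_diag f hf x (d := d)
  have h2 : polarForm f (fun _ : Fin d => x) = 0 := by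
    rw [polarForm_diag_expand]
    refine Finset.sum_eq_zero fun π _ => ?_
    have : polarForm f (fun k => basisTensor (π k))
        = G3 f (fun k => (π k).1) (fun k => (π k).2.1) (fun k => (π k).2.2) := rfl
    rw [this, hG, mul_zero]
  rw [h2] at h1
  exact (mul_eq_zero.mp h1.symm).resolve_right (coeff_ones_sum_X_pow_ne_zero d)

end Summit.MatrixMultiplication.MatrixMultiplication.Theorems.ObstructionDescentPolarLinear
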